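import Summits.QuantumFields.YangMills.Theorems.BalabanUVNodesN06AtOpsYOfLetters
import Literature.MathematicalPhysics.QuantumFieldTheory.Balaban1983to89.B9Thm313Whole
import Summits.QuantumFields.YangMills.Theorems.BalabanUVNodesN06AtRecord11ObligationsPins
import Summits.QuantumFields.YangMills.Theorems.BalabanUVNodesN06AtRecord11ObligationsPins2
import Literature.MathematicalPhysics.QuantumFieldTheory.Balaban1983to89.B9ResidualEntriesAtOne
import Literature.MathematicalPhysics.QuantumFieldTheory.Balaban1983to89.B9Cor35ComparisonsGAAtLetters
import Literature.MathematicalPhysics.QuantumFieldTheory.Balaban1983to89.B9Cor35ComparisonsGpCAtLetters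
import Literature.MathematicalPhysics.QuantumFieldTheory.Balaban1983to89.B9GeoLemma21KLevelV1
import Literature.MathematicalPhysics.QuantumFieldTheory.Balaban1983to89.B9Ineq347Reading

/-!
# BalabanUVNodes ∕ N06 ([B9], `Dag.B9_main`) — THE STAGE-11 CERTIFICATE AT def-Y's INSTANCE, II: rows 20 (`t312`, Theorem 3.12) and 21 (`t313`, Theorem 3.13) SUPPLIED
# from seat n06-l's leaves at the predicate pins (the per-row lemmas `t312_of_pins` ∕ `t313_of_pins` of `…ObligationsPins3`, here INLINE — that module's olean is not yet served) — NO original operator-layer binder of p449575 is left displayed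

Track A of `YM-PLAN.md` (cell `pub-ymgap`, HUMAN RULING D-0062), node **N06** = [Balaban1985BackgroundPropagators] Thms 3.1–3.15; seat
`pub-ymgap-dag-n06-d` gen 2 = dag-lead N06-ASSIGNMENT v1 (P3) «THE KNIT AT THE RECORD».  Sequel of `BalabanUVNodesN06AtOpsYOfLetters` (the certificate at
`ops := Node00.opsYOfLetters N θ M⋆ 𝔏 𝔈` with rows 1–8 discharged).

THE POINT.  The certificate's binder `t312 : B9.Thm312Printed (d₆+1) c35Y geo9Y (bg9Y …) GD G₁ H H₁ HasRWExp HasRWExpH PosDefK` (Theorem 3.12, pp. 421–423) is supplied by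
`…ObligationsPins3.t312_of_pins` (over seat n06-l's `B9Thm312WholeLeaf.thm312Printed_of_step`, p467704) at the instance: the layer's three predicate slots — fields of `𝔈` —
PINNED literally to n06-l's `HasRWExpOfOps ∕ HasRWExpHOfOps ∕ PosDefKOfOps (𝔬 x)`; displayed instead: the letters `𝔬`, the co-readings of `GD`, `G₁`, the per-U hypotheses
`hmodel` (Thm 3.3 for G₀, the (3.131)∕(3.138) steps, the smallness of the forms, the identities (3.130)) and the residual `hres`; the geometry, the signs and the generic row sum
are theorems of the record (discharged inside `t312_of_pins`).  Likewise `t313 : B9.Thm313Printed c35Y geo9Y (bg9Y …) GG HasRWExp PosDefK` (Theorem 3.13, pp. 424–425) by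
`t313_of_pins` (over n06-l's `B9Thm313Whole.thm313Printed_of_step`, p469293) from the SAME letter record and `hmodel`, the co-readings of `GG`, the ten printed-shape letters
`Letters313`, the residual of 𝔊.  After this link NONE of the 20 original operator-layer binders of p449575 (:209–262) is displayed: rows 1–8 are discharged at the instance,
rows 9–26 are supplied modulo the suppliers' displayed letters ∕ pins ∕ schemas ∕ readings ∕ residuals (listed binder by binder in the statement).

WHAT THIS MODULE DOES (kernel bookkeeping; 0 `def`, 0 `sorry`, standard axioms; COUNT-NEUTRAL, `--supports` K1 `StabilityBAtRecordR11e`):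
* `b9_main_of_up_view₁₁B10YZW_opsYOfLetters_r2021supplied` — the sequel's theorem with `t312`, `t313` REPLACED by n06-l's displayed inputs at the pins.

HONEST FRAMING.  The operator layer is def-Y's layer of LETTERS; every supplied row is supplied MODULO displayed hypothesis schemas of printed ∕ located shape; nothing of [B9]
is proved for Bałaban's operators; k stays 0 ∕ 28 in the referee's sense; N06 is NOT discharged.  One finite four-torus programme at fixed `ε` — NOT ℝ⁴, NOT OS, NOT a mass
gap, NOT Clay.  No `def`.
-/

noncomputable section

namespace Summit.QuantumFields.YangMills.BalabanUVNodes.N06AtOpsYOfLettersB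

open Literature.MathematicalPhysics.QuantumFieldTheory.Balaban1983to89
open Literature.MathematicalPhysics.QuantumFieldTheory.Balaban1983to89.T4Continuum (T4Family FiniteEpsData)
open Literature.MathematicalPhysics.QuantumFieldTheory.Balaban1983to89.DagBinding (WorldP leavesP B9LeafX)
open Literature.MathematicalPhysics.QuantumFieldTheory.Balaban1983to89.Node00
open Literature.MathematicalPhysics.QuantumFieldTheory.Balaban1983to89.B9PinMembersKLevelV1 (MemberY geo9Y bg9Y)
open Literature.MathematicalPhysics.QuantumFieldTheory.Balaban1983to89.B9PinGeometryKLevelV1 (dOmegaY OmKY inΛY unitDistY InCubeY c35Y c35Y_pos)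
open Literature.MathematicalPhysics.QuantumFieldTheory.Balaban1983to89.B7Prop2SpecialUnitary (specialUnitaryUnits)
open Literature.MathematicalPhysics.QuantumFieldTheory.Balaban1983to89.B9Thm37Whole (Ops Conv342 Sizes StaticOK Local342 Identities const37)
open Literature.MathematicalPhysics.QuantumFieldTheory.Balaban1983to89.B9Cor38Whole (WalkReading Locality W38OfOps)
open Literature.MathematicalPhysics.QuantumFieldTheory.Balaban1983to89.B9Thm37GlueCor36 (CoRealizes)
open Literature.MathematicalPhysics.QuantumFieldTheory.Balaban1983to89.B6RandomWalk (Ineq261)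
open Literature.MathematicalPhysics.QuantumFieldTheory.Balaban1983to89.B9Thm34Ext (toB6)
open Literature.MathematicalPhysics.QuantumFieldTheory.Balaban1983to89.B9Thm314 (Thm314LocalPrinted IneqSupF)
open Literature.MathematicalPhysics.QuantumFieldTheory.Balaban1983to89.B9SectBStepWhole
  (StepE StepL2n StepGlob StepH1 StepE4 StepH2 StepKer StepAnalytic)
open Literature.MathematicalPhysics.QuantumFieldTheory.Balaban1983to89.B9Ineq349Whole (Dict349)
open Literature.MathematicalPhysics.QuantumFieldTheory.Balaban1983to89.B9Eq3132Whole (CTInputs InvNormalised WeightsTransfer)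
open Literature.MathematicalPhysics.QuantumFieldTheory.Balaban1983to89.B9ResidualEntriesAtOne (AtOneL2On AtOneGlobOn AtOneH1On AtOneE4On AtOneH2On)
open Literature.MathematicalPhysics.QuantumFieldTheory.Balaban1983to89.B9Thm39Whole
  (Ops39 WalkReading39 EK39OfOps StaticOK39 Local348 Identities395 Small285 Factors389 Locality39 KerReads)
open Literature.MathematicalPhysics.QuantumFieldTheory.Balaban1983to89.B9Thm311Whole (Ops311 PosDefOfOps Inputs311)
open Literature.MathematicalPhysics.QuantumFieldTheory.Balaban1983to89.B9Thm310Whole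
  (Ops310 WalkReading310 Sizes310 StaticOK310 Locality310 Local342G Identities310 W310OfOps Conv3107)
open Literature.MathematicalPhysics.QuantumFieldTheory.Balaban1983to89.B9Thm315Whole (Ops315 Reads315 Static315 GivenBy3185OfOps HasRWExpCOfOps)
open Literature.MathematicalPhysics.QuantumFieldTheory.Balaban1983to89.B9Thm314Whole (DiffExpansionAllNorms RWSumFactorYieldsSupL2 RWSumFactorYieldsHolder)
open Literature.MathematicalPhysics.QuantumFieldTheory.Balaban1983to89.B9Ineq347Reading (GlobReading AtOneEOn Lemma21Above atOneGlobOn_of_atOneEOn)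
open Literature.MathematicalPhysics.QuantumFieldTheory.Balaban1983to89.B9GeoLemma21KLevelV1 (distOK_geo9Y levelGap_geo9Y_one rowSum261_geo9Y)
open Literature.MathematicalPhysics.QuantumFieldTheory.Balaban1983to89.B9GeoNormsKLevelModelSignsV1 (modelSignsOn_geo9K)
open Summit.QuantumFields.YangMills.BalabanUVNodes.N06AtRecord11ObligationsPins (t311_of_pin t310_of_pin hsumG_of_pin t314loc_of_leaves t315_of_pins)
open Literature.MathematicalPhysics.QuantumFieldTheory.Balaban1983to89.B9ResidualEntriesAtOne (hGp_of_blocksOn_of_null hGA_of_globOn_of_null)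
open Literature.MathematicalPhysics.QuantumFieldTheory.Balaban1983to89.B9Cor35ComparisonsGAAtLetters
  (hGA_e_opsYOfLetters hGA_h1_opsYOfLetters hGA_e4_opsYOfLetters hGA_h2_opsYOfLetters hGA_l2_opsYOfLetters hnullGA_opsYOfLetters)
open Literature.MathematicalPhysics.QuantumFieldTheory.Balaban1983to89.B9Cor35ComparisonsGpCAtLetters (hGp_e_opsYOfLetters hGp_h1_opsYOfLetters hC_opsYOfLetters)
open Summit.QuantumFields.YangMills.BalabanUVNodes.N06AtRecord11ObligationsPins2 (t39_of_pin hksum_of_pin s3132_of_inputs)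
open Literature.MathematicalPhysics.QuantumFieldTheory.Balaban1983to89.B9Thm312Whole (GeoOK Thm33G0 FormSmall HasRWExpOfOps HasRWExpHOfOps PosDefKOfOps)
open Literature.MathematicalPhysics.QuantumFieldTheory.Balaban1983to89.B11SectG (RowSum)
open Literature.MathematicalPhysics.QuantumFieldTheory.Balaban1983to89.B9FromB6 (L2Block)
open Literature.MathematicalPhysics.QuantumFieldTheory.Balaban1983to89.B9Thm37GlueCor36 (Clause342)
open Literature.MathematicalPhysics.QuantumFieldTheory.Balaban1983to89.B9Thm312WholeLeaf (thm312Printed_of_step)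
open Literature.MathematicalPhysics.QuantumFieldTheory.Balaban1983to89.B9Thm313Whole (Letters313 thm313Printed_of_step)
open Literature.MathematicalPhysics.QuantumFieldTheory.Balaban1983to89.B9GeoLemma21KLevelV1 (geo9Y_dist_triangle geo9Y_dist_comm geo9Y_len_pos)
open Literature.MathematicalPhysics.QuantumFieldTheory.Balaban1983to89.B9GeoNormsKLevelV1 (geo9K_dist_nonneg)
open Summit.QuantumFields.YangMills.BalabanUVNodes.N06AtOpsYOfLetters (b9_main_of_up_view₁₁B10YZW_opsYOfLetters)
open scoped Matrix.Norms.L2Operator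

variable {N : ℕ}

/-! ## THE KNIT AT ₁₁ AT def-Y's INSTANCE — rows 20, 21 supplied -/

section Pointed

variable [NeZero N] {F : T4Family}

/-- **THE STAGE-11 CERTIFICATE AT def-Y's INSTANCE WITH ROWS 20, 21 SUPPLIED**: the sequel's `b9_main_of_up_view₁₁B10YZW_opsYOfLetters` with `t312`, `t313` replaced by n06-l's
letters, co-readings, per-U model hypotheses, the (3.13) letters, residuals and the predicate pins (`t312_of_pins`, `t313_of_pins`); NO original operator-layer binder of the
certificate remains displayed — what is displayed are the suppliers' hypothesis schemas, binder by binder.  NOT a discharge of N06.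
[cite: Balaban1985BackgroundPropagators, Thm 3.12 (3.130)–(3.138) pp.421–423, Thm 3.13 (3.150)–(3.153) pp.424–425, Cor. 3.5 p.407] -/
theorem b9_main_of_up_view₁₁B10YZW_opsYOfLetters_r2021supplied (θ : Stage11Params F N) (hθ : θ.Admissible) (Mstar : ℕ)
    (𝔏 : LettersY N θ.toStage3Params Mstar) (𝔈 : ExpsY N θ.toStage3Params Mstar) (ζ : ResidZ F N) (lamW : ResidW F N) (w : WorldP)
    (hup : ∀ P, w.up P = upOfRecord₅C F N (θ.view₁₁B10YZW F N Mstar (opsYOfLetters N θ.toStage3Params Mstar 𝔏 𝔈) ζ lamW) P)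
    -- in place of `hB`: n06-c's fourteen printed block-steps of Sect. B (§1)
    (hA : StepAnalytic (θ.d₆ + 1) c35Y geo9Y (bg9Y (Matrix (Fin N) (Fin N) ℂ) (specialUnitaryUnits (Fin N))) (fun x => ((opsYOfLetters N θ.toStage3Params Mstar 𝔏 𝔈) x).Gp) (fun x => ((opsYOfLetters N θ.toStage3Params Mstar 𝔏 𝔈) x).GA)
      (fun x => ((opsYOfLetters N θ.toStage3Params Mstar 𝔏 𝔈) x).Cinv) (fun x => ((opsYOfLetters N θ.toStage3Params Mstar 𝔏 𝔈) x).IsAnalyticExt))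
    (hEp : StepE (θ.d₆ + 1) c35Y geo9Y (bg9Y (Matrix (Fin N) (Fin N) ℂ) (specialUnitaryUnits (Fin N))) (fun x => ((opsYOfLetters N θ.toStage3Params Mstar 𝔏 𝔈) x).Gp) (fun x => ((opsYOfLetters N θ.toStage3Params Mstar 𝔏 𝔈) x).GA)
      (fun x => ((opsYOfLetters N θ.toStage3Params Mstar 𝔏 𝔈) x).Cinv) (fun x => ((opsYOfLetters N θ.toStage3Params Mstar 𝔏 𝔈) x).Gp))
    (hLp : ∀ n : Fin 6, StepL2n (θ.d₆ + 1) c35Y geo9Y (bg9Y (Matrix (Fin N) (Fin N) ℂ) (specialUnitaryUnits (Fin N))) (fun x => ((opsYOfLetters N θ.toStage3Params Mstar 𝔏 𝔈) x).Gp) (fun x => ((opsYOfLetters N θ.toStage3Params Mstar 𝔏 𝔈) x).GA)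
      (fun x => ((opsYOfLetters N θ.toStage3Params Mstar 𝔏 𝔈) x).Cinv) (fun x => ((opsYOfLetters N θ.toStage3Params Mstar 𝔏 𝔈) x).Gp) n)
    (hGlp : StepGlob (θ.d₆ + 1) c35Y geo9Y (bg9Y (Matrix (Fin N) (Fin N) ℂ) (specialUnitaryUnits (Fin N))) (fun x => ((opsYOfLetters N θ.toStage3Params Mstar 𝔏 𝔈) x).Gp) (fun x => ((opsYOfLetters N θ.toStage3Params Mstar 𝔏 𝔈) x).GA)
      (fun x => ((opsYOfLetters N θ.toStage3Params Mstar 𝔏 𝔈) x).Cinv) (fun x => ((opsYOfLetters N θ.toStage3Params Mstar 𝔏 𝔈) x).Gp))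
    (hH1p : StepH1 (θ.d₆ + 1) c35Y geo9Y (bg9Y (Matrix (Fin N) (Fin N) ℂ) (specialUnitaryUnits (Fin N))) (fun x => ((opsYOfLetters N θ.toStage3Params Mstar 𝔏 𝔈) x).Gp) (fun x => ((opsYOfLetters N θ.toStage3Params Mstar 𝔏 𝔈) x).GA)
      (fun x => ((opsYOfLetters N θ.toStage3Params Mstar 𝔏 𝔈) x).Cinv) (fun x => ((opsYOfLetters N θ.toStage3Params Mstar 𝔏 𝔈) x).Gp))
    (hE4p : StepE4 (θ.d₆ + 1) c35Y geo9Y (bg9Y (Matrix (Fin N) (Fin N) ℂ) (specialUnitaryUnits (Fin N))) (fun x => ((opsYOfLetters N θ.toStage3Params Mstar 𝔏 𝔈) x).Gp) (fun x => ((opsYOfLetters N θ.toStage3Params Mstar 𝔏 𝔈) x).GA)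
      (fun x => ((opsYOfLetters N θ.toStage3Params Mstar 𝔏 𝔈) x).Cinv) (fun x => ((opsYOfLetters N θ.toStage3Params Mstar 𝔏 𝔈) x).Gp))
    (hH2p : StepH2 (θ.d₆ + 1) c35Y geo9Y (bg9Y (Matrix (Fin N) (Fin N) ℂ) (specialUnitaryUnits (Fin N))) (fun x => ((opsYOfLetters N θ.toStage3Params Mstar 𝔏 𝔈) x).Gp) (fun x => ((opsYOfLetters N θ.toStage3Params Mstar 𝔏 𝔈) x).GA)
      (fun x => ((opsYOfLetters N θ.toStage3Params Mstar 𝔏 𝔈) x).Cinv) (fun x => ((opsYOfLetters N θ.toStage3Params Mstar 𝔏 𝔈) x).Gp))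
    (hK : StepKer (θ.d₆ + 1) c35Y geo9Y (bg9Y (Matrix (Fin N) (Fin N) ℂ) (specialUnitaryUnits (Fin N))) (fun x => ((opsYOfLetters N θ.toStage3Params Mstar 𝔏 𝔈) x).Gp) (fun x => ((opsYOfLetters N θ.toStage3Params Mstar 𝔏 𝔈) x).GA)
      (fun x => ((opsYOfLetters N θ.toStage3Params Mstar 𝔏 𝔈) x).Cinv) (fun x => ((opsYOfLetters N θ.toStage3Params Mstar 𝔏 𝔈) x).Cinv))
    (hEa : StepE (θ.d₆ + 1) c35Y geo9Y (bg9Y (Matrix (Fin N) (Fin N) ℂ) (specialUnitaryUnits (Fin N))) (fun x => ((opsYOfLetters N θ.toStage3Params Mstar 𝔏 𝔈) x).Gp) (fun x => ((opsYOfLetters N θ.toStage3Params Mstar 𝔏 𝔈) x).GA)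
      (fun x => ((opsYOfLetters N θ.toStage3Params Mstar 𝔏 𝔈) x).Cinv) (fun x => ((opsYOfLetters N θ.toStage3Params Mstar 𝔏 𝔈) x).GA))
    (hLa : ∀ n : Fin 6, StepL2n (θ.d₆ + 1) c35Y geo9Y (bg9Y (Matrix (Fin N) (Fin N) ℂ) (specialUnitaryUnits (Fin N))) (fun x => ((opsYOfLetters N θ.toStage3Params Mstar 𝔏 𝔈) x).Gp) (fun x => ((opsYOfLetters N θ.toStage3Params Mstar 𝔏 𝔈) x).GA)
      (fun x => ((opsYOfLetters N θ.toStage3Params Mstar 𝔏 𝔈) x).Cinv) (fun x => ((opsYOfLetters N θ.toStage3Params Mstar 𝔏 𝔈) x).GA) n)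
    (hGla : StepGlob (θ.d₆ + 1) c35Y geo9Y (bg9Y (Matrix (Fin N) (Fin N) ℂ) (specialUnitaryUnits (Fin N))) (fun x => ((opsYOfLetters N θ.toStage3Params Mstar 𝔏 𝔈) x).Gp) (fun x => ((opsYOfLetters N θ.toStage3Params Mstar 𝔏 𝔈) x).GA)
      (fun x => ((opsYOfLetters N θ.toStage3Params Mstar 𝔏 𝔈) x).Cinv) (fun x => ((opsYOfLetters N θ.toStage3Params Mstar 𝔏 𝔈) x).GA))
    (hH1a : StepH1 (θ.d₆ + 1) c35Y geo9Y (bg9Y (Matrix (Fin N) (Fin N) ℂ) (specialUnitaryUnits (Fin N))) (fun x => ((opsYOfLetters N θ.toStage3Params Mstar 𝔏 𝔈) x).Gp) (fun x => ((opsYOfLetters N θ.toStage3Params Mstar 𝔏 𝔈) x).GA)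
      (fun x => ((opsYOfLetters N θ.toStage3Params Mstar 𝔏 𝔈) x).Cinv) (fun x => ((opsYOfLetters N θ.toStage3Params Mstar 𝔏 𝔈) x).GA))
    (hE4a : StepE4 (θ.d₆ + 1) c35Y geo9Y (bg9Y (Matrix (Fin N) (Fin N) ℂ) (specialUnitaryUnits (Fin N))) (fun x => ((opsYOfLetters N θ.toStage3Params Mstar 𝔏 𝔈) x).Gp) (fun x => ((opsYOfLetters N θ.toStage3Params Mstar 𝔏 𝔈) x).GA)
      (fun x => ((opsYOfLetters N θ.toStage3Params Mstar 𝔏 𝔈) x).Cinv) (fun x => ((opsYOfLetters N θ.toStage3Params Mstar 𝔏 𝔈) x).GA))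
    (hH2a : StepH2 (θ.d₆ + 1) c35Y geo9Y (bg9Y (Matrix (Fin N) (Fin N) ℂ) (specialUnitaryUnits (Fin N))) (fun x => ((opsYOfLetters N θ.toStage3Params Mstar 𝔏 𝔈) x).Gp) (fun x => ((opsYOfLetters N θ.toStage3Params Mstar 𝔏 𝔈) x).GA)
      (fun x => ((opsYOfLetters N θ.toStage3Params Mstar 𝔏 𝔈) x).Cinv) (fun x => ((opsYOfLetters N θ.toStage3Params Mstar 𝔏 𝔈) x).GA))
    -- in place of `t37`, `c38`, `hsum`: as in sequel II
    [∀ x : MemberY θ.d₆ θ.ℓ₆ θ.hd' θ.hL' θ.b₀ θ.b₁ Mstar, Fintype (geo9Y x).Site]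
    [∀ x : MemberY θ.d₆ θ.ℓ₆ θ.hd' θ.hL' θ.b₀ θ.b₁ Mstar, DecidableEq (geo9Y x).Site]
    {X Y ι : MemberY θ.d₆ θ.ℓ₆ θ.hd' θ.hL' θ.b₀ θ.b₁ Mstar → Type}
    [∀ x, Fintype (X x)] [∀ x, DecidableEq (X x)] [∀ x, Fintype (Y x)] [∀ x, DecidableEq (Y x)] [∀ x, Fintype (ι x)]
    -- rows 11–12 (seat n06-h): G′(1)'s per-block leaves ON site arguments (the null readings off the summands hold by `rfl` at the instance)
    (hGpL2 : AtOneL2On geo9Y (bg9Y (Matrix (Fin N) (Fin N) ℂ) (specialUnitaryUnits (Fin N))) (fun x => ((opsYOfLetters N θ.toStage3Params Mstar 𝔏 𝔈) x).Gp) (fun _ lam => ¬ (lam.isRight = true)))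
    (hGpH1 : AtOneH1On geo9Y (bg9Y (Matrix (Fin N) (Fin N) ℂ) (specialUnitaryUnits (Fin N))) (fun x => ((opsYOfLetters N θ.toStage3Params Mstar 𝔏 𝔈) x).Gp) (fun _ lam => ¬ (lam.isRight = true)))
    (hGpE4 : AtOneE4On geo9Y (bg9Y (Matrix (Fin N) (Fin N) ℂ) (specialUnitaryUnits (Fin N))) (fun x => ((opsYOfLetters N θ.toStage3Params Mstar 𝔏 𝔈) x).Gp) (fun _ lam => ¬ (lam.isRight = true)))
    (hGpH2 : AtOneH2On geo9Y (bg9Y (Matrix (Fin N) (Fin N) ℂ) (specialUnitaryUnits (Fin N))) (fun x => ((opsYOfLetters N θ.toStage3Params Mstar 𝔏 𝔈) x).Gp) (fun _ lam => ¬ (lam.isRight = true)))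
    -- the two (3.47) sub-leaves at U = 1 (seat n06-h's `B9Ineq347Reading`): (3.42) leaves ON the summand, glob-readings, [4] Lemma 2.1 in printed form
    {res resA : ∀ x : MemberY θ.d₆ θ.ℓ₆ θ.hd' θ.hL' θ.b₀ θ.b₁ Mstar, (geo9Y x).Site → (geo9Y x).Loc → (geo9Y x).Loc}
    (hRGp : ∀ x : MemberY θ.d₆ θ.ℓ₆ θ.hd' θ.hL' θ.b₀ θ.b₁ Mstar, GlobReading ((opsYOfLetters N θ.toStage3Params Mstar 𝔏 𝔈) x).Gp (fun lam => ¬ (lam.isRight = true)) (bg9Y (Matrix (Fin N) (Fin N) ℂ) (specialUnitaryUnits (Fin N)) x).one (res x))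
    (hRGA : ∀ x : MemberY θ.d₆ θ.ℓ₆ θ.hd' θ.hL' θ.b₀ θ.b₁ Mstar, GlobReading ((opsYOfLetters N θ.toStage3Params Mstar 𝔏 𝔈) x).GA (fun lam => lam.isRight = true) (bg9Y (Matrix (Fin N) (Fin N) ℂ) (specialUnitaryUnits (Fin N)) x).one (resA x))
    {d21 : ℕ} {R21 : MemberY θ.d₆ θ.ℓ₆ θ.hd' θ.hL' θ.b₀ θ.b₁ Mstar → ℝ} {H21 : MemberY θ.d₆ θ.ℓ₆ θ.hd' θ.hL' θ.b₀ θ.b₁ Mstar → Prop} {α21 : ℝ}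
    (hL21 : ∀ δ' : ℝ, 0 < δ' → ∃ ML' : ℝ,
      Lemma21Above d21 (geo9Y (d := θ.d₆) (ℓ := θ.ℓ₆) (hd := θ.hd') (hL := θ.hL') (b₀ := θ.b₀) (b₁ := θ.b₁) (Mstar := Mstar)) R21 H21 δ' α21 ML')
    (hEGp : AtOneEOn geo9Y (bg9Y (Matrix (Fin N) (Fin N) ℂ) (specialUnitaryUnits (Fin N))) (fun x => ((opsYOfLetters N θ.toStage3Params Mstar 𝔏 𝔈) x).Gp) (fun _ lam => ¬ (lam.isRight = true)))
    (hEGA : AtOneEOn geo9Y (bg9Y (Matrix (Fin N) (Fin N) ℂ) (specialUnitaryUnits (Fin N))) (fun x => ((opsYOfLetters N θ.toStage3Params Mstar 𝔏 𝔈) x).GA) (fun _ lam => lam.isRight = true))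
    -- rows 15–16 (seat n06-j): the (3.98) expansion pinned to the letters of Q′G′²Q′*, its schemas, the kernel reading of (Q′G′²Q′*)⁻¹
    {ι39 κ39 : MemberY θ.d₆ θ.ℓ₆ θ.hd' θ.hL' θ.b₀ θ.b₁ Mstar → Type} [∀ x, Fintype (ι39 x)]
    (𝔬39 : ∀ x : MemberY θ.d₆ θ.ℓ₆ θ.hd' θ.hL' θ.b₀ θ.b₁ Mstar, Ops39 (geo9Y x) (bg9Y (Matrix (Fin N) (Fin N) ℂ) (specialUnitaryUnits (Fin N)) x) (ι39 x) (κ39 x))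
    (rd39 : ∀ x : MemberY θ.d₆ θ.ℓ₆ θ.hd' θ.hL' θ.b₀ θ.b₁ Mstar, WalkReading39 (bg9Y (Matrix (Fin N) (Fin N) ℂ) (specialUnitaryUnits (Fin N)) x) (ι39 x) (κ39 x))
    (R39 : MemberY θ.d₆ θ.ℓ₆ θ.hd' θ.hL' θ.b₀ θ.b₁ Mstar → ℝ) (H39 : MemberY θ.d₆ θ.ℓ₆ θ.hd' θ.hL' θ.b₀ θ.b₁ Mstar → Prop) (α39 α' r39 δ39 θ39 B39 N39 a39 M39 ML39 : ℝ)
    (h39α : 0 ≤ α39) (h39α1 : α39 < 1) (hα' : α' ≤ 1) (hr39 : 0 ≤ r39) (hrδ39 : r39 ≤ δ39) (hδ39 : 0 < δ39) (hθ39 : 0 ≤ θ39)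
    (hB39 : 0 < B39) (hN39 : 0 ≤ N39) (ha39 : 0 < a39) (hM39 : 0 < M39)
    (hst39 : ∀ x, StaticOK39 (𝔬39 x) N39) (hloc39 : ∀ x, Locality39 (𝔬39 x) (rd39 x))
    (h261_39 : ∀ x : MemberY θ.d₆ θ.ℓ₆ θ.hd' θ.hL' θ.b₀ θ.b₁ Mstar, ML39 ≤ (geo9Y x).M →
      Ineq261 (θ.d₆ + 1) (toB6 (geo9Y x) (R39 x) (H39 x)) δ39 α39 ∧ Ineq261 (θ.d₆ + 1) (toB6 (geo9Y x) (R39 x) (H39 x)) r39 α')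
    (h39 : ∀ x : MemberY θ.d₆ θ.ℓ₆ θ.hd' θ.hL' θ.b₀ θ.b₁ Mstar, M39 ≤ (geo9Y x).M → ∀ α₀ : ℝ, 0 < α₀ → c35Y * (geo9Y x).M * α₀ ≤ a39 →
      ∀ U : (bg9Y (Matrix (Fin N) (Fin N) ℂ) (specialUnitaryUnits (Fin N)) x).Cfg, (bg9Y (Matrix (Fin N) (Fin N) ℂ) (specialUnitaryUnits (Fin N)) x).Reg335 c35Y α₀ U →
        Local348 (𝔬39 x) (θ.d₆ + 1) B39 δ39 U ∧ Identities395 (𝔬39 x) U ∧ Small285 (𝔬39 x) (θ.d₆ + 1) θ39 r39 U ∧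
          Factors389 (𝔬39 x) (θ.d₆ + 1) θ39 δ39 U)
    (hEK39 : ∀ x : MemberY θ.d₆ θ.ℓ₆ θ.hd' θ.hL' θ.b₀ θ.b₁ Mstar, ((opsYOfLetters N θ.toStage3Params Mstar 𝔏 𝔈) x).EK39 = EK39OfOps (𝔬39 x) (rd39 x) (θ.d₆ + 1) (2 * (N39 * B39) * B6.c1 (θ.d₆ + 1) r39 α') ((1 - α') * r39))
    (hB₁39 : 0 < 2 * (N39 * B39) * B6.c1 (θ.d₆ + 1) r39 α') (hδ₁39 : 0 < (1 - α') * r39)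
    (hrdC : ∀ x : MemberY θ.d₆ θ.ℓ₆ θ.hd' θ.hL' θ.b₀ θ.b₁ Mstar, KerReads (𝔬39 x) ((opsYOfLetters N θ.toStage3Params Mstar 𝔏 𝔈) x).Cinv (θ.d₆ + 1))
    -- row 26 (seat n06-i): Combes–Thomas inputs, normalisation readings of (QGQ*)⁻¹ ∕ (QG₁Q*)⁻¹, weights transfer
    {S32 S32₁ : ∀ x : MemberY θ.d₆ θ.ℓ₆ θ.hd' θ.hL' θ.b₀ θ.b₁ Mstar, (bg9Y (Matrix (Fin N) (Fin N) ℂ) (specialUnitaryUnits (Fin N)) x).Cfg → Matrix (geo9Y x).Site (geo9Y x).Site ℝ}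
    {w32 w32₁ : ∀ x : MemberY θ.d₆ θ.ℓ₆ θ.hd' θ.hL' θ.b₀ θ.b₁ Mstar, (geo9Y x).Site → ℝ}
    (hCT : CTInputs c35Y geo9Y (bg9Y (Matrix (Fin N) (Fin N) ℂ) (specialUnitaryUnits (Fin N))) S32) (hCT₁ : CTInputs c35Y geo9Y (bg9Y (Matrix (Fin N) (Fin N) ℂ) (specialUnitaryUnits (Fin N))) S32₁)
    (hN32 : ∀ x : MemberY θ.d₆ θ.ℓ₆ θ.hd' θ.hL' θ.b₀ θ.b₁ Mstar, InvNormalised ((opsYOfLetters N θ.toStage3Params Mstar 𝔏 𝔈) x).QGQinv (S32 x) (w32 x)) (hN32₁ : ∀ x : MemberY θ.d₆ θ.ℓ₆ θ.hd' θ.hL' θ.b₀ θ.b₁ Mstar, InvNormalised ((opsYOfLetters N θ.toStage3Params Mstar 𝔏 𝔈) x).QG1Qinv (S32₁ x) (w32₁ x))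
    {A32 : ℝ} (hA32 : 0 < A32)
    (hwt : ∀ ε : ℝ, 0 < ε → ∃ Mw : ℝ, ∀ x : MemberY θ.d₆ θ.ℓ₆ θ.hd' θ.hL' θ.b₀ θ.b₁ Mstar, Mw ≤ (geo9Y x).M →
      WeightsTransfer (geo9Y x) (θ.d₆ + 1) (w32 x) ε A32 ∧ WeightsTransfer (geo9Y x) (θ.d₆ + 1) (w32₁ x) ε A32)
    (𝔬 : ∀ x, Ops (geo9Y x) (bg9Y (Matrix (Fin N) (Fin N) ℂ) (specialUnitaryUnits (Fin N)) x) (X x) (Y x) (ι x))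
    (rd : ∀ x, WalkReading (geo9Y x) (bg9Y (Matrix (Fin N) (Fin N) ℂ) (specialUnitaryUnits (Fin N)) x) (X x) (ι x))
    (R : MemberY θ.d₆ θ.ℓ₆ θ.hd' θ.hL' θ.b₀ θ.b₁ Mstar → ℝ) (H : MemberY θ.d₆ θ.ℓ₆ θ.hd' θ.hL' θ.b₀ θ.b₁ Mstar → Prop)
    (κ : MemberY θ.d₆ θ.ℓ₆ θ.hd' θ.hL' θ.b₀ θ.b₁ Mstar → Sizes) (d : ℕ) (α ρ Nc N' Cℓ K θ₀ B₀ δ₀ a₁ M₁ ML : ℝ)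
    (hα : 0 ≤ α) (hα2 : α ≤ 1 / 2) (hN : 0 ≤ Nc) (hN' : 0 ≤ N') (hCℓ : 1 ≤ Cℓ) (hK0 : 0 ≤ K) (hθ₀ : 0 ≤ θ₀) (hB₀ : 0 < B₀) (hδ₀ : 0 < δ₀)
    (ha₁ : 0 < a₁) (hM₁ : 0 < M₁)
    (hst : ∀ x, StaticOK (𝔬 x) ρ Nc N' Cℓ (κ x)) (hκ : ∀ x, (κ x).Bounded K θ₀ Cℓ (geo9Y x).M)
    (hrd : ∀ x, (rd x).OK (𝔬 x).blk) (hloc : ∀ x, Locality (𝔬 x) (rd x))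
    (h261 : ∀ x, ML ≤ (geo9Y x).M → Ineq261 d (toB6 (geo9Y x) (R x) (H x)) δ₀ α)
    (h36 : ∀ x, M₁ ≤ (geo9Y x).M → ∀ α₀ : ℝ, 0 < α₀ → c35Y * (geo9Y x).M * α₀ ≤ a₁ →
      ∀ U : (bg9Y (Matrix (Fin N) (Fin N) ℂ) (specialUnitaryUnits (Fin N)) x).Cfg,
        (bg9Y (Matrix (Fin N) (Fin N) ℂ) (specialUnitaryUnits (Fin N)) x).Reg335 c35Y α₀ U →
          Local342 (𝔬 x) (R x) (H x) B₀ δ₀ U ∧ Identities (𝔬 x) (R x) (H x) U)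
    (hE38 : ∀ x, ((opsYOfLetters N θ.toStage3Params Mstar 𝔏 𝔈) x).E37 = W38OfOps (𝔬 x) (rd x) (R x) (H x) (const37 d δ₀ α ρ B₀ Nc N' Cℓ K) ((1 - 2 * α) * δ₀))
    (evY : ∀ x : MemberY θ.d₆ θ.ℓ₆ θ.hd' θ.hL' θ.b₀ θ.b₁ Mstar, (geo9Y x).Loc → Y x → ℝ)
    (hco0 : ∀ x U, CoRealizes ((opsYOfLetters N θ.toStage3Params Mstar 𝔏 𝔈) x).Gp 0 U (𝔬 x).blk (𝔬 x).blk (rd x).ev ((𝔬 x).Gp U))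
    (hco1 : ∀ x U, CoRealizes ((opsYOfLetters N θ.toStage3Params Mstar 𝔏 𝔈) x).Gp 1 U (𝔬 x).blkY (𝔬 x).blk (rd x).ev ((𝔬 x).D U ∘ₗ (𝔬 x).Gp U))
    (hco2 : ∀ x U, CoRealizes ((opsYOfLetters N θ.toStage3Params Mstar 𝔏 𝔈) x).Gp 2 U (𝔬 x).blk (𝔬 x).blkY (evY x) ((𝔬 x).Gp U ∘ₗ (𝔬 x).Dstar U))
    (hco3 : ∀ x U, CoRealizes ((opsYOfLetters N θ.toStage3Params Mstar 𝔏 𝔈) x).Gp 3 U (𝔬 x).blk (𝔬 x).blk (rd x).ev ((𝔬 x).Lap U ∘ₗ (𝔬 x).Gp U))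
    {B₁ δ₁ : ℝ} (hB₁ : 0 < B₁) (hδ₁ : 0 < δ₁) (hCB : const37 d δ₀ α ρ B₀ Nc N' Cℓ K ≤ B₁) (hδ₁le : δ₁ ≤ (1 - 2 * α) * δ₀)
    {Bβ Bε : ℝ → ℝ} {Bεβ : ℝ → ℝ → ℝ}
    (hrest : ∀ (x : MemberY θ.d₆ θ.ℓ₆ θ.hd' θ.hL' θ.b₀ θ.b₁ Mstar) (U : (bg9Y (Matrix (Fin N) (Fin N) ℂ) (specialUnitaryUnits (Fin N)) x).Cfg),
      (((opsYOfLetters N θ.toStage3Params Mstar 𝔏 𝔈) x).E37).Converges U →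
        (∀ (n : Fin 6) (lam : (geo9Y x).Loc) (h : (geo9Y x).Cut) (y y' : (geo9Y x).Site), (geo9Y x).cutIn h y → (geo9Y x).suppIn lam y' →
            ((opsYOfLetters N θ.toStage3Params Mstar 𝔏 𝔈) x).Gp.l2 n U lam h ≤ B₁ * B9.pref6 ((geo9Y x).len y) n * (geo9Y x).cutSup h * Real.exp (-(δ₁ * (geo9Y x).dist y y')) * (geo9Y x).l2Norm lam) ∧
        (∀ (n : Fin 4) (lam : (geo9Y x).Loc) (γ : ℝ), -4 ≤ γ → γ ≤ 4 → ((opsYOfLetters N θ.toStage3Params Mstar 𝔏 𝔈) x).Gp.glob n U lam γ ≤ B₁ * (geo9Y x).wNorm γ lam) ∧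
        B9.Ineq343_345 ((opsYOfLetters N θ.toStage3Params Mstar 𝔏 𝔈) x).Gp Bβ Bε Bεβ δ₁ U)
    -- row 17 (seat n06-j): the letters of Theorem 3.11, the printed proof's inputs under the provisos, the literal pin of `PosDef`
    {E7 F7 W7 : MemberY θ.d₆ θ.ℓ₆ θ.hd' θ.hL' θ.b₀ θ.b₁ Mstar → Type} [∀ x, NormedAddCommGroup (E7 x)] [∀ x, InnerProductSpace ℝ (E7 x)] [∀ x, NormedAddCommGroup (F7 x)]
    [∀ x, InnerProductSpace ℝ (F7 x)] [∀ x, NormedAddCommGroup (W7 x)] [∀ x, InnerProductSpace ℝ (W7 x)] [∀ x, FiniteDimensional ℝ (W7 x)]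
    (𝔬311 : ∀ x : MemberY θ.d₆ θ.ℓ₆ θ.hd' θ.hL' θ.b₀ θ.b₁ Mstar, Ops311 (bg9Y (Matrix (Fin N) (Fin N) ℂ) (specialUnitaryUnits (Fin N)) x) (E7 x) (F7 x) (W7 x)) (θ311 a311 M311 : ℝ) (ha311 : 0 < a311) (hM311 : 0 < M311)
    (h311 : ∀ x : MemberY θ.d₆ θ.ℓ₆ θ.hd' θ.hL' θ.b₀ θ.b₁ Mstar, M311 ≤ (geo9Y x).M → ∀ α₀ : ℝ, 0 < α₀ → (geo9Y x).M * α₀ ≤ a311 →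
      ∀ U : (bg9Y (Matrix (Fin N) (Fin N) ℂ) (specialUnitaryUnits (Fin N)) x).Cfg, (bg9Y (Matrix (Fin N) (Fin N) ℂ) (specialUnitaryUnits (Fin N)) x).Reg335 c35Y α₀ U → Inputs311 (𝔬311 x) θ311 (geo9Y x).M U)
    (hPD : ∀ x : MemberY θ.d₆ θ.ℓ₆ θ.hd' θ.hL' θ.b₀ θ.b₁ Mstar, ((opsYOfLetters N θ.toStage3Params Mstar 𝔏 𝔈) x).PosDef = PosDefOfOps (𝔬311 x))
    -- row 18 (seat n06-k): the letters of Theorem 3.10, its schemas, the literal pin of `E310`; the co-readings of `GA` by those letters; the G-half residual of `hsum`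
    {X3 Y3 ι3 A3 : MemberY θ.d₆ θ.ℓ₆ θ.hd' θ.hL' θ.b₀ θ.b₁ Mstar → Type} [∀ x, Fintype (X3 x)] [∀ x, DecidableEq (X3 x)] [∀ x, Fintype (Y3 x)] [∀ x, DecidableEq (Y3 x)]
    [∀ x, Fintype (ι3 x)] [∀ x, Fintype (A3 x)]
    (𝔬310 : ∀ x : MemberY θ.d₆ θ.ℓ₆ θ.hd' θ.hL' θ.b₀ θ.b₁ Mstar, Ops310 (geo9Y x) (bg9Y (Matrix (Fin N) (Fin N) ℂ) (specialUnitaryUnits (Fin N)) x) (X3 x) (Y3 x) (ι3 x) (A3 x))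
    (rd310 : ∀ x : MemberY θ.d₆ θ.ℓ₆ θ.hd' θ.hL' θ.b₀ θ.b₁ Mstar, WalkReading310 (geo9Y x) (bg9Y (Matrix (Fin N) (Fin N) ℂ) (specialUnitaryUnits (Fin N)) x) (X3 x) (ι3 x) (A3 x))
    (R310 : MemberY θ.d₆ θ.ℓ₆ θ.hd' θ.hL' θ.b₀ θ.b₁ Mstar → ℝ) (H310 : MemberY θ.d₆ θ.ℓ₆ θ.hd' θ.hL' θ.b₀ θ.b₁ Mstar → Prop) (κ310 : MemberY θ.d₆ θ.ℓ₆ θ.hd' θ.hL' θ.b₀ θ.b₁ Mstar → Sizes310)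
    (d3 : ℕ) (α3 ρ3 N3 N3' NF3 Cℓ3 K3 θ3 B3 δ3 a3 M3 ML3 : ℝ)
    (hα3 : 0 ≤ α3) (hα3' : α3 ≤ 1 / 2) (hN3 : 0 ≤ N3) (hN3' : 0 ≤ N3') (hNF3 : 0 ≤ NF3) (hCℓ3 : 1 ≤ Cℓ3) (hK3 : 0 ≤ K3) (hθ3 : 0 ≤ θ3) (hB3 : 0 < B3)
    (hδ3 : 0 < δ3) (ha3 : 0 < a3) (hM3 : 0 < M3)
    (hst3 : ∀ x, StaticOK310 (𝔬310 x) ρ3 N3 N3' NF3 Cℓ3 (κ310 x)) (hκ3 : ∀ x, (κ310 x).Bounded K3)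
    (hrd3 : ∀ x, (rd310 x).OK (𝔬310 x).blk) (hloc3 : ∀ x, Locality310 (𝔬310 x) (rd310 x))
    (h261_3 : ∀ x : MemberY θ.d₆ θ.ℓ₆ θ.hd' θ.hL' θ.b₀ θ.b₁ Mstar, ML3 ≤ (geo9Y x).M → Ineq261 d3 (toB6 (geo9Y x) (R310 x) (H310 x)) δ3 α3)
    (h36_3 : ∀ x : MemberY θ.d₆ θ.ℓ₆ θ.hd' θ.hL' θ.b₀ θ.b₁ Mstar, M3 ≤ (geo9Y x).M → ∀ α₀ : ℝ, 0 < α₀ → c35Y * (geo9Y x).M * α₀ ≤ a3 →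
      ∀ U : (bg9Y (Matrix (Fin N) (Fin N) ℂ) (specialUnitaryUnits (Fin N)) x).Cfg, (bg9Y (Matrix (Fin N) (Fin N) ℂ) (specialUnitaryUnits (Fin N)) x).Reg335 c35Y α₀ U →
        Local342G (𝔬310 x) (R310 x) (H310 x) B3 δ3 U ∧ B9Thm310Whole.Factors389 (𝔬310 x) (R310 x) (H310 x) θ3 δ3 U ∧
          Identities310 (𝔬310 x) (R310 x) (H310 x) U)
    (hE310 : ∀ x : MemberY θ.d₆ θ.ℓ₆ θ.hd' θ.hL' θ.b₀ θ.b₁ Mstar, ((opsYOfLetters N θ.toStage3Params Mstar 𝔏 𝔈) x).E310 = W310OfOps (𝔬310 x) (rd310 x)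
      (Conv3107 (𝔬310 x) (R310 x) (H310 x) (const37 d3 δ3 α3 ρ3 B3 N3 N3' Cℓ3 K3) ((1 - 2 * α3) * δ3)))
    (ev3 : ∀ x : MemberY θ.d₆ θ.ℓ₆ θ.hd' θ.hL' θ.b₀ θ.b₁ Mstar, (geo9Y x).Loc → X3 x → ℝ) (evY3 : ∀ x : MemberY θ.d₆ θ.ℓ₆ θ.hd' θ.hL' θ.b₀ θ.b₁ Mstar, (geo9Y x).Loc → Y3 x → ℝ)
    (hcoA0 : ∀ x U, CoRealizes ((opsYOfLetters N θ.toStage3Params Mstar 𝔏 𝔈) x).GA 0 U (𝔬310 x).blk (𝔬310 x).blk (ev3 x) ((𝔬310 x).G U))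
    (hcoA1 : ∀ x U, CoRealizes ((opsYOfLetters N θ.toStage3Params Mstar 𝔏 𝔈) x).GA 1 U (𝔬310 x).blkY (𝔬310 x).blk (ev3 x) ((𝔬310 x).D U ∘ₗ (𝔬310 x).G U))
    (hcoA2 : ∀ x U, CoRealizes ((opsYOfLetters N θ.toStage3Params Mstar 𝔏 𝔈) x).GA 2 U (𝔬310 x).blk (𝔬310 x).blkY (evY3 x) ((𝔬310 x).G U ∘ₗ (𝔬310 x).Dstar U))
    (hcoA3 : ∀ x U, CoRealizes ((opsYOfLetters N θ.toStage3Params Mstar 𝔏 𝔈) x).GA 3 U (𝔬310 x).blk (𝔬310 x).blk (ev3 x) ((𝔬310 x).Lap U ∘ₗ (𝔬310 x).G U))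
    (hCB3 : const37 d3 δ3 α3 ρ3 B3 N3 N3' Cℓ3 K3 ≤ B₁) (hδ₁le3 : δ₁ ≤ (1 - 2 * α3) * δ3)
    (hrestA : ∀ (x : MemberY θ.d₆ θ.ℓ₆ θ.hd' θ.hL' θ.b₀ θ.b₁ Mstar) (U : (bg9Y (Matrix (Fin N) (Fin N) ℂ) (specialUnitaryUnits (Fin N)) x).Cfg),
      (((opsYOfLetters N θ.toStage3Params Mstar 𝔏 𝔈) x).E310).Converges U →
        (∀ (n : Fin 6) (lam : (geo9Y x).Loc) (h : (geo9Y x).Cut) (y y' : (geo9Y x).Site), (geo9Y x).cutIn h y → (geo9Y x).suppIn lam y' →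
            ((opsYOfLetters N θ.toStage3Params Mstar 𝔏 𝔈) x).GA.l2 n U lam h ≤ B₁ * B9.pref6 ((geo9Y x).len y) n * (geo9Y x).cutSup h * Real.exp (-(δ₁ * (geo9Y x).dist y y')) * (geo9Y x).l2Norm lam) ∧
        (∀ (n : Fin 4) (lam : (geo9Y x).Loc) (γ : ℝ), -4 ≤ γ → γ ≤ 4 → ((opsYOfLetters N θ.toStage3Params Mstar 𝔏 𝔈) x).GA.glob n U lam γ ≤ B₁ * (geo9Y x).wNorm γ lam) ∧
        B9.Ineq343_345 ((opsYOfLetters N θ.toStage3Params Mstar 𝔏 𝔈) x).GA Bβ Bε Bεβ δ₁ U)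
    -- row 23 (seat n06-m): the leaves of Theorem 3.14's printed proof at the local reading, the M-uniform diameter bound (flag T314 (ii))
    {Ediff : ∀ x : MemberY θ.d₆ θ.ℓ₆ θ.hd' θ.hL' θ.b₀ θ.b₁ Mstar, B9.RWExpansion (geo9Y x) (bg9Y (Matrix (Fin N) (Fin N) ℂ) (specialUnitaryUnits (Fin N)) x)}
    {termK : ∀ x : MemberY θ.d₆ θ.ℓ₆ θ.hd' θ.hL' θ.b₀ θ.b₁ Mstar, (Ediff x).Walk → B9.KernelFamily (geo9Y x) (bg9Y (Matrix (Fin N) (Fin N) ℂ) (specialUnitaryUnits (Fin N)) x)}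
    (D314 : ∀ x : MemberY θ.d₆ θ.ℓ₆ θ.hd' θ.hL' θ.b₀ θ.b₁ Mstar, B9Thm314.LocData (geo9Y x) (bg9Y (Matrix (Fin N) (Fin N) ℂ) (specialUnitaryUnits (Fin N)) x) (Ediff x)) (L314 : ∀ x, (D314 x).Laws (dOmegaY x)) (r314 : ℝ)
    (hr314 : ∀ x, (D314 x).diam ≤ r314)
    (hA314 : DiffExpansionAllNorms c35Y geo9Y (bg9Y (Matrix (Fin N) (Fin N) ℂ) (specialUnitaryUnits (Fin N))) Ediff termK (fun x => (D314 x).Touches))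
    (hS314 : RWSumFactorYieldsSupL2 geo9Y (bg9Y (Matrix (Fin N) (Fin N) ℂ) (specialUnitaryUnits (Fin N))) Ediff termK (fun x => ((opsYOfLetters N θ.toStage3Params Mstar 𝔏 𝔈) x).Kdiff) OmKY)
    (hH314 : RWSumFactorYieldsHolder geo9Y (bg9Y (Matrix (Fin N) (Fin N) ℂ) (specialUnitaryUnits (Fin N))) Ediff termK (fun x => ((opsYOfLetters N θ.toStage3Params Mstar 𝔏 𝔈) x).Kdiff) OmKY)
    -- row 24 (seat n06-m): the letters of Theorem 3.15, the reading of `Ck`, the locality, the two pinned clauses under the printed prefix, the slot implications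
    {𝔸5 : Type} [NormedRing 𝔸5] {P5 W5 : MemberY θ.d₆ θ.ℓ₆ θ.hd' θ.hL' θ.b₀ θ.b₁ Mstar → Type} [∀ x, Fintype (P5 x)]
    (𝔬315 : ∀ x : MemberY θ.d₆ θ.ℓ₆ θ.hd' θ.hL' θ.b₀ θ.b₁ Mstar, Ops315 (geo9Y x) (bg9Y (Matrix (Fin N) (Fin N) ℂ) (specialUnitaryUnits (Fin N)) x) 𝔸5 (P5 x) (W5 x)) {K5 r5 m5 a5 δ5 B5 : ℝ}
    (hK5 : 0 < K5) (hm5 : 0 < m5) (ha5 : 0 < a5) (hδ5 : 0 < δ5) (hB5 : 0 < B5)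
    (hR5 : ∀ x : MemberY θ.d₆ θ.ℓ₆ θ.hd' θ.hL' θ.b₀ θ.b₁ Mstar, Reads315 (𝔬315 x) ((opsYOfLetters N θ.toStage3Params Mstar 𝔏 𝔈) x).Ck (inΛY x) K5) (hS5 : ∀ x : MemberY θ.d₆ θ.ℓ₆ θ.hd' θ.hL' θ.b₀ θ.b₁ Mstar, Static315 (𝔬315 x) (unitDistY x) r5 m5)
    (h315 : ∀ (x : MemberY θ.d₆ θ.ℓ₆ θ.hd' θ.hL' θ.b₀ θ.b₁ Mstar) (α₀ : ℝ), 0 < α₀ → (geo9Y x).M * α₀ ≤ a5 →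
      ∀ U : (bg9Y (Matrix (Fin N) (Fin N) ℂ) (specialUnitaryUnits (Fin N)) x).Cfg, (bg9Y (Matrix (Fin N) (Fin N) ℂ) (specialUnitaryUnits (Fin N)) x).Reg335 c35Y α₀ U → (bg9Y (Matrix (Fin N) (Fin N) ℂ) (specialUnitaryUnits (Fin N)) x).Reg336 c35Y α₀ U →
        GivenBy3185OfOps (𝔬315 x) U ∧ HasRWExpCOfOps (𝔬315 x) (unitDistY x) B5 U δ5)
    (hG315 : ∀ (x : MemberY θ.d₆ θ.ℓ₆ θ.hd' θ.hL' θ.b₀ θ.b₁ Mstar) (U : (bg9Y (Matrix (Fin N) (Fin N) ℂ) (specialUnitaryUnits (Fin N)) x).Cfg), GivenBy3185OfOps (𝔬315 x) U → ((opsYOfLetters N θ.toStage3Params Mstar 𝔏 𝔈) x).GivenBy3185 U)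
    (hH315 : ∀ (x : MemberY θ.d₆ θ.ℓ₆ θ.hd' θ.hL' θ.b₀ θ.b₁ Mstar) (U : (bg9Y (Matrix (Fin N) (Fin N) ℂ) (specialUnitaryUnits (Fin N)) x).Cfg) (δ' : ℝ), HasRWExpCOfOps (𝔬315 x) (unitDistY x) B5 U δ' → ((opsYOfLetters N θ.toStage3Params Mstar 𝔏 𝔈) x).HasRWExpC U δ')
    -- in place of `t314`: (γ) and (β) of sequel III
    (r : ℝ)
    (hgeo : ∀ (x : MemberY θ.d₆ θ.ℓ₆ θ.hd' θ.hL' θ.b₀ θ.b₁ Mstar) (y y' : (geo9Y x).Site), ¬ (OmKY x y ∧ OmKY x y') →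
      dOmegaY x y y' ≤ (geo9Y x).dist y y' + r)
    (hplain : ∃ M₁ δ₁ a₁ B₁ : ℝ, 0 < M₁ ∧ 0 < δ₁ ∧ 0 < a₁ ∧ 0 < B₁ ∧
      ∀ x : MemberY θ.d₆ θ.ℓ₆ θ.hd' θ.hL' θ.b₀ θ.b₁ Mstar, M₁ ≤ (geo9Y x).M → ∀ α₀ : ℝ, 0 < α₀ → (geo9Y x).M * α₀ ≤ a₁ →
        ∀ U : (bg9Y (Matrix (Fin N) (Fin N) ℂ) (specialUnitaryUnits (Fin N)) x).Cfg,
          (bg9Y (Matrix (Fin N) (Fin N) ℂ) (specialUnitaryUnits (Fin N)) x).Reg335 c35Y α₀ U → IneqSupF ((opsYOfLetters N θ.toStage3Params Mstar 𝔏 𝔈) x).Kdiff B₁ δ₁ (fun _ => True) (fun _ _ => 1) U)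
    -- the remaining printed leaves, verbatim
    -- row 20 (seat n06-l): the letters of Theorem 3.12, co-readings of `GD`∕`G₁`, the per-U model hypotheses, the residual, the three predicate pins
    {X12 Y12 Z12 W12 : MemberY θ.d₆ θ.ℓ₆ θ.hd' θ.hL' θ.b₀ θ.b₁ Mstar → Type} [∀ x, Fintype (X12 x)] [∀ x, DecidableEq (X12 x)] [∀ x, Fintype (Y12 x)] [∀ x, Fintype (Z12 x)]
    [∀ x, Fintype (W12 x)]
    (𝔬12 : ∀ x : MemberY θ.d₆ θ.ℓ₆ θ.hd' θ.hL' θ.b₀ θ.b₁ Mstar, B9Thm312Whole.Ops (geo9Y x) (bg9Y (Matrix (Fin N) (Fin N) ℂ) (specialUnitaryUnits (Fin N)) x) (X12 x) (Y12 x) (Z12 x) (W12 x)) (R12 : MemberY θ.d₆ θ.ℓ₆ θ.hd' θ.hL' θ.b₀ θ.b₁ Mstar → ℝ) (H12 : MemberY θ.d₆ θ.ℓ₆ θ.hd' θ.hL' θ.b₀ θ.b₁ Mstar → Prop)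
    (ev12 : ∀ x : MemberY θ.d₆ θ.ℓ₆ θ.hd' θ.hL' θ.b₀ θ.b₁ Mstar, (geo9Y x).Loc → X12 x → ℝ) (evY12 : ∀ x : MemberY θ.d₆ θ.ℓ₆ θ.hd' θ.hL' θ.b₀ θ.b₁ Mstar, (geo9Y x).Loc → Y12 x → ℝ)
    (θ12 r12 B12₀ δ12₀ δK12 σ12 ρ12 a12 M12 B12₁ δ12₁ : ℝ) (Bβ12 Bε12 : ℝ → ℝ) (Bεβ12 : ℝ → ℝ → ℝ)
    (hθ12 : 0 ≤ θ12) (hr12 : 0 ≤ r12) (hB12₀ : 0 ≤ B12₀) (hρ12 : 0 < ρ12) (hρS12 : ρ12 ≤ δ12₀) (hρδ12 : ρ12 + σ12 ≤ δK12) (hσ12 : 0 < σ12)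
    (ha12 : 0 < a12) (hM12 : 0 < M12) (hB12₁ : 0 ≤ B12₁) (hδ12₁ : 0 < δ12₁) (hBβ12 : ∀ β, 0 ≤ Bβ12 β) (hBε12 : ∀ ε, 0 ≤ Bε12 ε)
    (hBεβ12 : ∀ ε β, 0 ≤ Bεβ12 ε β)
    (hco12 : ∀ (x : MemberY θ.d₆ θ.ℓ₆ θ.hd' θ.hL' θ.b₀ θ.b₁ Mstar) (U : (bg9Y (Matrix (Fin N) (Fin N) ℂ) (specialUnitaryUnits (Fin N)) x).Cfg),
      CoRealizes ((opsYOfLetters N θ.toStage3Params Mstar 𝔏 𝔈) x).GD 0 U (𝔬12 x).blk (𝔬12 x).blk (ev12 x) ((𝔬12 x).G U) ∧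
      CoRealizes ((opsYOfLetters N θ.toStage3Params Mstar 𝔏 𝔈) x).GD 2 U (𝔬12 x).blk (𝔬12 x).blkY (evY12 x) ((𝔬12 x).G U ∘ₗ (𝔬12 x).Dstar U) ∧
      CoRealizes ((opsYOfLetters N θ.toStage3Params Mstar 𝔏 𝔈) x).G₁ 0 U (𝔬12 x).blk (𝔬12 x).blk (ev12 x) ((𝔬12 x).G1 U) ∧
      CoRealizes ((opsYOfLetters N θ.toStage3Params Mstar 𝔏 𝔈) x).G₁ 2 U (𝔬12 x).blk (𝔬12 x).blkY (evY12 x) ((𝔬12 x).G1 U ∘ₗ (𝔬12 x).Dstar U))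
    (hmodel12 : ∀ x : MemberY θ.d₆ θ.ℓ₆ θ.hd' θ.hL' θ.b₀ θ.b₁ Mstar, M12 ≤ (geo9Y x).M → ∀ α₀ : ℝ, 0 < α₀ → (geo9Y x).M * α₀ ≤ a12 →
      ∀ U : (bg9Y (Matrix (Fin N) (Fin N) ℂ) (specialUnitaryUnits (Fin N)) x).Cfg, (bg9Y (Matrix (Fin N) (Fin N) ℂ) (specialUnitaryUnits (Fin N)) x).Reg335 c35Y α₀ U → (bg9Y (Matrix (Fin N) (Fin N) ℂ) (specialUnitaryUnits (Fin N)) x).Reg336 c35Y α₀ U →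
        Thm33G0 (𝔬12 x) (R12 x) (H12 x) B12₀ δ12₀ U ∧
        B9Thm312Whole.Step (𝔬12 x) (R12 x) (H12 x) (fun y => (geo9Y_len_pos x y).le) 1 (θ12 * ((geo9Y x).M * α₀)) δK12 U ∧
        B9Thm312Whole.Step (𝔬12 x) (R12 x) (H12 x) (fun y => (geo9Y_len_pos x y).le) 2 (θ12 * ((geo9Y x).M * α₀)) δK12 U ∧
        FormSmall (𝔬12 x) (r12 * ((geo9Y x).M * α₀)) U ∧ B9Thm312Whole.Identities (𝔬12 x) U)
    (hres12 : ∀ x : MemberY θ.d₆ θ.ℓ₆ θ.hd' θ.hL' θ.b₀ θ.b₁ Mstar, M12 ≤ (geo9Y x).M → ∀ α₀ : ℝ, 0 < α₀ → (geo9Y x).M * α₀ ≤ a12 →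
      ∀ U : (bg9Y (Matrix (Fin N) (Fin N) ℂ) (specialUnitaryUnits (Fin N)) x).Cfg, (bg9Y (Matrix (Fin N) (Fin N) ℂ) (specialUnitaryUnits (Fin N)) x).Reg335 c35Y α₀ U → (bg9Y (Matrix (Fin N) (Fin N) ℂ) (specialUnitaryUnits (Fin N)) x).Reg336 c35Y α₀ U →
        (∀ K ∈ [((opsYOfLetters N θ.toStage3Params Mstar 𝔏 𝔈) x).GD, ((opsYOfLetters N θ.toStage3Params Mstar 𝔏 𝔈) x).G₁], Clause342 K 1 B12₁ δ12₁ U ∧ L2Block K B12₁ δ12₁ U ∧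
          (∀ (n : Fin 4) (lam : (geo9Y x).Loc) (γ : ℝ), n ≠ 3 → -4 ≤ γ → γ ≤ 4 →
            K.glob n U lam γ ≤ B12₁ * (geo9Y x).wNorm γ lam) ∧
          B9.Ineq343_345 K Bβ12 Bε12 Bεβ12 δ12₁ U) ∧
        (∀ Hk' ∈ [((opsYOfLetters N θ.toStage3Params Mstar 𝔏 𝔈) x).H, ((opsYOfLetters N θ.toStage3Params Mstar 𝔏 𝔈) x).H₁], B9.Ineq3133 (θ.d₆ + 1) Hk' B12₁ Bβ12 δ12₁ U))
    (hpinE : ∀ x : MemberY θ.d₆ θ.ℓ₆ θ.hd' θ.hL' θ.b₀ θ.b₁ Mstar, ((opsYOfLetters N θ.toStage3Params Mstar 𝔏 𝔈) x).HasRWExp = HasRWExpOfOps (𝔬12 x))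
    (hpinH : ∀ x : MemberY θ.d₆ θ.ℓ₆ θ.hd' θ.hL' θ.b₀ θ.b₁ Mstar, ((opsYOfLetters N θ.toStage3Params Mstar 𝔏 𝔈) x).HasRWExpH = HasRWExpHOfOps (𝔬12 x))
    (hpinK : ∀ x : MemberY θ.d₆ θ.ℓ₆ θ.hd' θ.hL' θ.b₀ θ.b₁ Mstar, ((opsYOfLetters N θ.toStage3Params Mstar 𝔏 𝔈) x).PosDefK = PosDefKOfOps (𝔬12 x))
    -- row 21 (seat n06-l): the co-readings of `GG`, the ten letters between the state norms, the residual of 𝔊 (same `𝔬12`, same `hmodel12` as row 20)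
    (B13 δ13 ρ13 : ℝ) (hB13 : 0 ≤ B13) (hρ13 : 0 < ρ13) (hρ13ρ : ρ13 + 3 * σ12 ≤ ρ12) (hρδ13 : ρ12 ≤ δ13)
    (hco13 : ∀ (x : MemberY θ.d₆ θ.ℓ₆ θ.hd' θ.hL' θ.b₀ θ.b₁ Mstar) (U : (bg9Y (Matrix (Fin N) (Fin N) ℂ) (specialUnitaryUnits (Fin N)) x).Cfg),
      CoRealizes ((opsYOfLetters N θ.toStage3Params Mstar 𝔏 𝔈) x).GG 0 U (𝔬12 x).blk (𝔬12 x).blk (ev12 x) ((𝔬12 x).GG U) ∧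
      CoRealizes ((opsYOfLetters N θ.toStage3Params Mstar 𝔏 𝔈) x).GG 2 U (𝔬12 x).blk (𝔬12 x).blkY (evY12 x) ((𝔬12 x).GG U ∘ₗ (𝔬12 x).Dstar U))
    (hletters13 : ∀ x : MemberY θ.d₆ θ.ℓ₆ θ.hd' θ.hL' θ.b₀ θ.b₁ Mstar, M12 ≤ (geo9Y x).M → ∀ α₀ : ℝ, 0 < α₀ → (geo9Y x).M * α₀ ≤ a12 →
      ∀ U : (bg9Y (Matrix (Fin N) (Fin N) ℂ) (specialUnitaryUnits (Fin N)) x).Cfg, (bg9Y (Matrix (Fin N) (Fin N) ℂ) (specialUnitaryUnits (Fin N)) x).Reg335 c35Y α₀ U → (bg9Y (Matrix (Fin N) (Fin N) ℂ) (specialUnitaryUnits (Fin N)) x).Reg336 c35Y α₀ U →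
        Letters313 (𝔬12 x) (R12 x) (H12 x) ⟨geo9Y_dist_triangle x, geo9Y_dist_comm x, geo9K_dist_nonneg x.toKIdx, geo9Y_len_pos x⟩ B13 δ13 U)
    (hres13 : ∀ x : MemberY θ.d₆ θ.ℓ₆ θ.hd' θ.hL' θ.b₀ θ.b₁ Mstar, M12 ≤ (geo9Y x).M → ∀ α₀ : ℝ, 0 < α₀ → (geo9Y x).M * α₀ ≤ a12 →
      ∀ U : (bg9Y (Matrix (Fin N) (Fin N) ℂ) (specialUnitaryUnits (Fin N)) x).Cfg, (bg9Y (Matrix (Fin N) (Fin N) ℂ) (specialUnitaryUnits (Fin N)) x).Reg335 c35Y α₀ U → (bg9Y (Matrix (Fin N) (Fin N) ℂ) (specialUnitaryUnits (Fin N)) x).Reg336 c35Y α₀ U →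
        Clause342 ((opsYOfLetters N θ.toStage3Params Mstar 𝔏 𝔈) x).GG 1 B12₁ δ12₁ U ∧ L2Block ((opsYOfLetters N θ.toStage3Params Mstar 𝔏 𝔈) x).GG B12₁ δ12₁ U ∧
          (∀ (n : Fin 4) (lam : (geo9Y x).Loc) (γ : ℝ), n ≠ 3 → -4 ≤ γ → γ ≤ 4 →
            (((opsYOfLetters N θ.toStage3Params Mstar 𝔏 𝔈) x).GG).glob n U lam γ ≤ B12₁ * (geo9Y x).wNorm γ lam) ∧
          B9.Ineq343_345 ((opsYOfLetters N θ.toStage3Params Mstar 𝔏 𝔈) x).GG Bβ12 Bε12 Bεβ12 δ12₁ U)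
    -- in place of `s349`: n06-i's (3.25) dictionary (row 25; the record-geometry facts are n06-i's theorems `B9GeoLemma21KLevelV1.*`)
    (hdict : ∀ x : MemberY θ.d₆ θ.ℓ₆ θ.hd' θ.hL' θ.b₀ θ.b₁ Mstar, Dict349 ((opsYOfLetters N θ.toStage3Params Mstar 𝔏 𝔈) x).Gp ((opsYOfLetters N θ.toStage3Params Mstar 𝔏 𝔈) x).Cinv ((opsYOfLetters N θ.toStage3Params Mstar 𝔏 𝔈) x).P349)
    (P : B12.RunParams) : Dag.B9_main (leavesP w P) := by
  have hgeoOK : ∀ x : MemberY θ.d₆ θ.ℓ₆ θ.hd' θ.hL' θ.b₀ θ.b₁ Mstar, GeoOK (geo9Y x) := fun x => ⟨geo9Y_dist_triangle x, geo9Y_dist_comm x, geo9K_dist_nonneg x.toKIdx, geo9Y_len_pos x⟩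
  obtain ⟨ML12, c12, hrow12⟩ := rowSum261_geo9Y (d := θ.d₆) (ℓ := θ.ℓ₆) (hd := θ.hd') (hL := θ.hL') (b₀ := θ.b₀) (b₁ := θ.b₁) (Mstar := Mstar) σ12 hσ12
  have hrow : ∀ x : MemberY θ.d₆ θ.ℓ₆ θ.hd' θ.hL' θ.b₀ θ.b₁ Mstar, ML12 ≤ (geo9Y x).M → RowSum (toB6 (geo9Y x) (R12 x) (H12 x)) σ12 (max c12 0) :=
    fun x hM y => (hrow12 x hM y).trans (le_max_left _ _)
  have hE : (fun x => ((opsYOfLetters N θ.toStage3Params Mstar 𝔏 𝔈) x).HasRWExp) = fun x => HasRWExpOfOps (𝔬12 x) := funext hpinE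
  have hH : (fun x => ((opsYOfLetters N θ.toStage3Params Mstar 𝔏 𝔈) x).HasRWExpH) = fun x => HasRWExpHOfOps (𝔬12 x) := funext hpinH
  have hK' : (fun x => ((opsYOfLetters N θ.toStage3Params Mstar 𝔏 𝔈) x).PosDefK) = fun x => PosDefKOfOps (𝔬12 x) := funext hpinK
  have t312 : B9.Thm312Printed (θ.d₆ + 1) c35Y geo9Y (bg9Y (Matrix (Fin N) (Fin N) ℂ) (specialUnitaryUnits (Fin N))) (fun x => ((opsYOfLetters N θ.toStage3Params Mstar 𝔏 𝔈) x).GD) (fun x => ((opsYOfLetters N θ.toStage3Params Mstar 𝔏 𝔈) x).G₁)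
      (fun x => ((opsYOfLetters N θ.toStage3Params Mstar 𝔏 𝔈) x).H) (fun x => ((opsYOfLetters N θ.toStage3Params Mstar 𝔏 𝔈) x).H₁) (fun x => ((opsYOfLetters N θ.toStage3Params Mstar 𝔏 𝔈) x).HasRWExp) (fun x => ((opsYOfLetters N θ.toStage3Params Mstar 𝔏 𝔈) x).HasRWExpH)
      (fun x => ((opsYOfLetters N θ.toStage3Params Mstar 𝔏 𝔈) x).PosDefK) := by
    rw [hE, hH, hK']
    exact thm312Printed_of_step 𝔬12 R12 H12 (fun x => ((opsYOfLetters N θ.toStage3Params Mstar 𝔏 𝔈) x).GD) (fun x => ((opsYOfLetters N θ.toStage3Params Mstar 𝔏 𝔈) x).G₁) (fun x => ((opsYOfLetters N θ.toStage3Params Mstar 𝔏 𝔈) x).H)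
      (fun x => ((opsYOfLetters N θ.toStage3Params Mstar 𝔏 𝔈) x).H₁) ev12 evY12 θ12 r12 B12₀ δ12₀ δK12 σ12 (max c12 0) ρ12 a12 M12 ML12 B12₁ δ12₁ Bβ12 Bε12 Bεβ12 hθ12 hr12 hB12₀ hρ12 hρS12
      hρδ12 (le_max_right _ _) ha12 hM12 hB12₁ hδ12₁ hBβ12 hBε12 hBεβ12 hgeoOK (fun x => modelSignsOn_geo9K x.toKIdx) hrow hco12 hmodel12 hres12
  have t313 : B9.Thm313Printed c35Y geo9Y (bg9Y (Matrix (Fin N) (Fin N) ℂ) (specialUnitaryUnits (Fin N))) (fun x => ((opsYOfLetters N θ.toStage3Params Mstar 𝔏 𝔈) x).GG) (fun x => ((opsYOfLetters N θ.toStage3Params Mstar 𝔏 𝔈) x).HasRWExp) (fun x => ((opsYOfLetters N θ.toStage3Params Mstar 𝔏 𝔈) x).PosDefK) := by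
    rw [hE, hK']
    exact thm313Printed_of_step 𝔬12 R12 H12 (fun x => ((opsYOfLetters N θ.toStage3Params Mstar 𝔏 𝔈) x).GG) ev12 evY12 θ12 r12 B12₀ δ12₀ δK12 σ12 (max c12 0) ρ12 a12 M12 ML12 B12₁ δ12₁ B13
      δ13 ρ13 Bβ12 Bε12 Bεβ12 hθ12 hr12 hB12₀ hB13 hσ12.le hρ13 hρ13ρ hρS12 hρδ13 hρδ12 (le_max_right _ _) ha12 hM12 hB12₁ hδ12₁ hBβ12 hBε12 hBεβ12 hgeoOK
      (fun x => modelSignsOn_geo9K x.toKIdx) hrow hco13 hmodel12 hletters13 hres13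
  exact b9_main_of_up_view₁₁B10YZW_opsYOfLetters θ hθ Mstar 𝔏 𝔈 ζ lamW w hup hA hEp hLp hGlp hH1p hE4p hH2p hK hEa hLa hGla hH1a hE4a hH2a hGpL2 hGpH1
    hGpE4 hGpH2 hRGp hRGA hL21 hEGp hEGA 𝔬39 rd39 R39 H39 α39 α' r39 δ39 θ39 B39 N39 a39 M39 ML39 h39α h39α1 hα' hr39 hrδ39 hδ39 hθ39 hB39 hN39 ha39
    hM39 hst39 hloc39 h261_39 h39 hEK39 hB₁39 hδ₁39 hrdC hCT hCT₁ hN32 hN32₁ hA32 hwt 𝔬 rd R H κ d α ρ Nc N' Cℓ K θ₀ B₀ δ₀ a₁ M₁ ML hα hα2 hN hN' hCℓ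
    hK0 hθ₀ hB₀ hδ₀ ha₁ hM₁ hst hκ hrd hloc h261 h36 hE38 evY hco0 hco1 hco2 hco3 hB₁ hδ₁ hCB hδ₁le hrest 𝔬311 θ311 a311 M311 ha311 hM311 h311 hPD
    𝔬310 rd310 R310 H310 κ310 d3 α3 ρ3 N3 N3' NF3 Cℓ3 K3 θ3 B3 δ3 a3 M3 ML3 hα3 hα3' hN3 hN3' hNF3 hCℓ3 hK3 hθ3 hB3 hδ3 ha3 hM3 hst3 hκ3 hrd3 hloc3
    h261_3 h36_3 hE310 ev3 evY3 hcoA0 hcoA1 hcoA2 hcoA3 hCB3 hδ₁le3 hrestA D314 L314 r314 hr314 hA314 hS314 hH314 𝔬315 hK5 hm5 ha5 hδ5 hB5 hR5 hS5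
    h315 hG315 hH315 r hgeo hplain t312 t313 hdict P

end Pointed

end Summit.QuantumFields.YangMills.BalabanUVNodes.N06AtOpsYOfLettersB

end
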